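import Summits.BirchSwinnertonDyer.BirchSwinnertonDyer.Theorems.ResidualThetaTransportAtTwoSignedMuVanishingAtTwoPlusMultOneHabitat
import Literature.NumberTheory.EllipticCurves.NewformsIotaHeckeAtLevelPrimesProofs
import Literature.NumberTheory.EllipticCurves.Gamma0CocycleDegeneracyMaps
import Literature.NumberTheory.EllipticCurves.NewformsTwistPacketProofs
import HarnessLib

/-!
# Route `ResidualThetaTransportAtTwo`, crux Kμ⁺ `SignedMuVanishingAtTwoPlus` (stmt-BirchSwinnertonDyer-20689), line
# `birth`, stub `stub_flatMuZeroAtTwo`: the OLD FAMILY of the old-class descent at a single level-raising prime —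
# `N_W = N₀ · q` — CONSTRUCTED (degeneracy maps `δ₁, δ_q`, the old form `H = g + g∣[diag(q,1)]`, and its `U_p`-bookkeeping)

Cell `bsd-wall`, width seat `bsd-wall-rtt-p4-w2` (g4). THEOREMS ONLY (no `def`, no `sorry`); helper `--supports` the crux; closes
nothing. BSD is not proved by this.

## What is proved
For a normalised newform `g ∈ S₂(Γ₀(N₀))` with rational (integer) eigenvalues `B p`, a prime `q ∤ N₀`, and the level
`N = N₀ q`, put `D₁ = degeneracyMap0 N₀ N 1 2 g` (`= g` as a form of level `N`), `D_q = degeneracyMap0 N₀ N q 2 g`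
(`= q · g(qτ)`) and `H = D₁ + D_q`. Then (`§1`):
* `{∞,γ∞}_H = {∞,δ₁γ∞}_g + {∞,δ_qγ∞}_g` (`cuspSymbol_degeneracyMap0`), `δ_t = Gamma0.degeneracyConj N₀ N t`;
* `T_p H = a_p(g) H` for `p ∤ N` (`heckeT_degeneracyMap0_of_isNewform0`) and for `p ∣ N₀` (`heckeT_iota_of_not_dvd_of_dvd_level`);
* `T_q H = (a_q(g) + q) D₁ − D_q` (`heckeT_iota_of_not_dvd_of_not_dvd_level`, `heckeT_iota_of_dvd`), hence, when `a_q(g)` is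
  EVEN, the doubled real periods of `H` satisfy the mod-2 `U_q`-bookkeeping `m_σ ≡ m_γ` for `{∞,σ∞} = U_q^∨{∞,γ∞}`
  (`q` odd) — the hypothesis `hbad` of `…OldClassCongruence` at `p = q`, with `a_q(f)` odd on the other side.
`§2` `flatAtTwo_of_namedFacts_of_prime_level`: FLAT at `(W, f)` on the habitat⁺ with `N_W = N₀ q` from the four named facts
of `…MultOneHabitat`, a congruent rational newform `g` of level `N₀` (`a_q(g)` even, `a_p(f) ≡ a_p(g)` for `p ≠ q`), and ONE odd
doubled plus symbol of `g` — the old family and its bookkeeping being now CONSTRUCTED (`S = {1, q}`).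

References: A. O. L. Atkin, J. Lehner, Math. Ann. 185 (1970) Lemma 15 [AtkinLehner1970]; F. Diamond, J. Shurman, GTM 228,
Prop. 5.2.2, §5.7, Prop. 5.8.5 [DiamondShurman2005]; J. E. Cremona (1997) §2.4 [CremonaAlgorithms1997]; K. Ribet, ICM 1983
(level raising; the old classes `g, g(qτ)`) [Ribet1984Congruence]; M. Emerton, R. Pollack, T. Weston (2006) §4.4
[EmertonPollackWeston2006].
-/

set_option autoImplicit false
set_option linter.dupNamespace false

noncomputable section

open scoped Classical MatrixGroups ModularForm

open CongruenceSubgroup WeierstrassCurve Literature.NumberTheory.EllipticCurves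
  Literature.NumberTheory.EllipticCurves.ModularForms Literature.NumberTheory.EllipticCurves.Rank1Residual
  Literature.NumberTheory.IwasawaTheory Summit.BirchSwinnertonDyer.Rank1Residual.Supersingular
  Summit.BirchSwinnertonDyer.BirchSwinnertonDyer.Theses.ResidualThetaTransportAtTwo

namespace Summit.BirchSwinnertonDyer.BirchSwinnertonDyer.Theorems.SignedMuAtTwo

namespace MultOneDictionary

/-! ## §1. The old family `H = D₁ + D_q` at level `N = N₀ q` -/

section OldFamily

variable {N₀ N : ℕ} [NeZero N₀] [NeZero N]

omit [NeZero N₀] [NeZero N] in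
/-- `ι_d` does not depend on how `d` is written (`1 * q = q`). [folklore] -/
theorem iota_congr {d₁ d₂ : ℕ} [NeZero d₁] [NeZero d₂] (e : d₁ = d₂) (h₁ : N₀ * d₁ ∣ N) (h₂ : N₀ * d₂ ∣ N) {k : ℤ}
    (g : CuspForm (Gamma0 N₀) k) : iota N₀ N d₁ k h₁ g = iota N₀ N d₂ k h₂ g := by
  subst e; rfl

/-- In weight `2`, `degeneracyMap0 N₀ N d 2 g = d • ι_d g`. [cite: DiamondShurman2005, §5.7 (definition of ι_d)] -/
theorem degeneracyMap0_two_eq {d : ℕ} [NeZero d] (h : N₀ * d ∣ N) (g : CuspForm (Gamma0 N₀) 2) :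
    degeneracyMap0 N₀ N d 2 g = (d : ℂ) • iota N₀ N d 2 h g := by
  rw [degeneracyMap0_eq_smul_iota N₀ N d 2 h, show ((2 : ℤ) - 1) = 1 by norm_num, zpow_one]

/-- **`U_q` on the old family at a single level-raising prime.** `g` a normalised newform of level `N₀`, `q ∤ N₀` prime,
`N = N₀ q`, `D₁ = degeneracyMap0 N₀ N 1 2 g`, `D_q = degeneracyMap0 N₀ N q 2 g`: `T_q (D₁ + D_q) = (a_q(g) + q) D₁ − D_q`
(`T_q ι₁ g = a_q ι₁ g − q ι_q g`, `T_q ι_q g = ι₁ g`, `D₁ = ι₁ g`, `D_q = q ι_q g`). [cite: DiamondShurman2005, Prop. 5.2.2 (a), §5.7, Prop. 5.8.5]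
[cite: AtkinLehner1970, Lemma 15] -/
theorem heckeT_oldFamily_levelRaisingPrime {q : ℕ} (hq : q.Prime) (hqN₀ : ¬ q ∣ N₀) (hN : N₀ * q = N)
    (g : CuspForm (Gamma0 N₀) 2) (hg : IsNewform0 g) :
    (haveI : NeZero q := ⟨hq.ne_zero⟩; heckeT (Gamma0 N) 2 q
      (degeneracyMap0 N₀ N 1 2 g + degeneracyMap0 N₀ N q 2 g)) =
      (cuspCoeff g q + q) • degeneracyMap0 N₀ N 1 2 g - (haveI : NeZero q := ⟨hq.ne_zero⟩; degeneracyMap0 N₀ N q 2 g) := by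
  haveI : NeZero q := ⟨hq.ne_zero⟩
  haveI : NeZero (1 * q) := ⟨by rw [one_mul]; exact hq.ne_zero⟩
  have h1 : N₀ * 1 ∣ N := ⟨q, by rw [mul_one, hN]⟩
  have hq' : N₀ * q ∣ N := by rw [hN]
  have h1q : N₀ * (1 * q) ∣ N := by rw [one_mul, hN]
  have hqN : q ∣ N := ⟨N₀, by rw [← hN, mul_comm]⟩
  have hD1 : degeneracyMap0 N₀ N 1 2 g = iota N₀ N 1 2 h1 g := by
    rw [degeneracyMap0_two_eq h1, Nat.cast_one, one_smul]
  have hDq : degeneracyMap0 N₀ N q 2 g = (q : ℂ) • iota N₀ N (1 * q) 2 h1q g := by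
    rw [degeneracyMap0_two_eq hq', iota_congr (one_mul q).symm hq' h1q]
  have hT1 : heckeT (Gamma0 N) 2 q (iota N₀ N 1 2 h1 g) =
      cuspCoeff g q • iota N₀ N 1 2 h1 g - (q : ℂ) • iota N₀ N (1 * q) 2 h1q g := by
    rw [heckeT_iota_of_not_dvd_of_not_dvd_level hq hqN hqN₀ (d := 1) (by simp [hq.one_lt.ne']) h1 h1q hg,
      show ((2 : ℤ) - 1) = 1 by norm_num, zpow_one]
  have hTq : heckeT (Gamma0 N) 2 q (iota N₀ N (1 * q) 2 h1q g) = iota N₀ N 1 2 h1 g :=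
    heckeT_iota_of_dvd hq hqN (d' := 1) h1q h1 g
  rw [map_add, hD1, hDq, map_smul, hT1, hTq, add_smul]
  module

/-- **`U_p` on the old family for `p ∣ N₀`** (`p ∤ q`): `T_p D_d = a_p(g) D_d` for `d ∈ {1, q}` (`a_{pm}(g) = a_p a_m` at the
primes of the level), so `T_p (D₁ + D_q) = a_p(g) (D₁ + D_q)`. [cite: DiamondShurman2005, Prop. 5.2.2 (a), Prop. 5.8.5 and §5.7] -/
theorem heckeT_oldFamily_of_dvd_level {q : ℕ} (hq : q.Prime) (hN : N₀ * q = N) (g : CuspForm (Gamma0 N₀) 2) (hg : IsNewform0 g)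
    {p : ℕ} (hp : p.Prime) (hpN₀ : p ∣ N₀) (hpq : p ≠ q) :
    (haveI : NeZero p := ⟨hp.ne_zero⟩; haveI : NeZero q := ⟨hq.ne_zero⟩; heckeT (Gamma0 N) 2 p
      (degeneracyMap0 N₀ N 1 2 g + degeneracyMap0 N₀ N q 2 g)) =
      cuspCoeff g p • (haveI : NeZero q := ⟨hq.ne_zero⟩; degeneracyMap0 N₀ N 1 2 g + degeneracyMap0 N₀ N q 2 g) := by
  haveI : NeZero p := ⟨hp.ne_zero⟩
  haveI : NeZero q := ⟨hq.ne_zero⟩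
  have h1 : N₀ * 1 ∣ N := ⟨q, by rw [mul_one, hN]⟩
  have hq' : N₀ * q ∣ N := by rw [hN]
  have hpN : p ∣ N := hpN₀.trans ⟨q, hN.symm⟩
  have hp1 : ¬ p ∣ 1 := by simp [hp.one_lt.ne']
  have hpq' : ¬ p ∣ q := fun h ↦ hpq ((Nat.prime_dvd_prime_iff_eq hp hq).mp h)
  rw [map_add, degeneracyMap0_two_eq h1, degeneracyMap0_two_eq hq', map_smul, map_smul,
    heckeT_iota_of_not_dvd_of_dvd_level hp hpN hpN₀ hp1 h1 hg, heckeT_iota_of_not_dvd_of_dvd_level hp hpN hpN₀ hpq' hq' hg,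
    smul_add, smul_comm (cuspCoeff g p) ((1 : ℕ) : ℂ), smul_comm (cuspCoeff g p) ((q : ℕ) : ℂ)]

end OldFamily

/-! ## §2. FLAT on the habitat⁺ at a single level-raising prime, with the old family constructed -/

section Habitat

variable {W : WeierstrassCurve ℚ} [W.IsElliptic] [W.IsGloballyMinimal]

/-- **FLAT at `(W, f)` for `N_W = N₀ · q`, old family constructed.** `W/ℚ` globally minimal, good supersingular at `2` with
`a₂(W) = 0`, `Δ_W < 0`, newform `f` (eigenvalues `A p`); `N_W = N₀ q` with `q` a prime not dividing `N₀`; `g` a normalised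
newform of level `N₀` with rational coefficients and eigenvalues `B p`, `a_q(g) = B q` EVEN, `A q` ODD (for the habitat `W` is
multiplicative at `q ∥ N_W`, `a_q(W) = ±1`), and `a_p(f) ≡ a_p(g) (mod 2)` for every prime `p ≠ q` (for `p ∤ N_W` this is the
residual congruence `W[2] ≅ A[2]`, `…MultOneCongruence`; for `p ∣ N₀` a finite check); ONE odd `2([b/4^k]⁺_g − [0]⁺_g)`.
GRANTED the four named facts of `…MultOneHabitat`: `2 ∤ L♭` for every Pollack pair `(L♯, L♭)` of `f` at `2`. The old family
is `S = {1, q}`, `δ_t = Gamma0.degeneracyConj N₀ N_W t`, `H = degeneracyMap0 N₀ N_W 1 2 g + degeneracyMap0 N₀ N_W q 2 g`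
(§1 supplies `hH`, `hgood`, `hbad`). [cite: Buzzard2000LevelLoweringModTwo, Prop. 2.4] [cite: DarmonDiamondTaylor1995, §1.6 Lemma 1.38]
[cite: SerreInventiones1972, §1.11 Prop. 12] [cite: Mazur1978, Thm. 1] [cite: EmertonPollackWeston2006, §4.4]
[cite: DiamondShurman2005, Prop. 5.2.2 (a), §5.7, Prop. 5.8.5] -/
theorem flatAtTwo_of_namedFacts_of_prime_level (hBuz : buzzard2000_multiplicityOne_gamma0)
    (hSe : serre1972_supersingular_decompositionSubgroup_image) (hSD : heckeSelfDual_torsionBy_J0)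
    (hMK : mazurKenku_exists_cyclic_isogeny)
    (hss : GoodSS W 2) (ha : W.frobeniusTrace 2 = 0) (hΔ : W.Δ < 0) [NeZero (W.conductorNorm ℤ)]
    {f : CuspForm (Gamma0 (W.conductorNorm ℤ)) 2} (hf : IsNewformOf W f)
    (A : ℕ → ℤ) (hA : ∀ p : ℕ, p.Prime → cuspCoeff f p = (A p : ℂ))
    {N₀ q : ℕ} [NeZero N₀] (hq : q.Prime) (hqN₀ : ¬ q ∣ N₀) (hN : N₀ * q = W.conductorNorm ℤ)
    (g : CuspForm (Gamma0 N₀) 2) (hg : IsNewform0 g) (hQg : coeffField g = ⊥)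
    (B : ℕ → ℤ) (hB : ∀ p : ℕ, p.Prime → cuspCoeff g p = (B p : ℂ)) (hBq : Even (B q)) (hAq : Odd (A q))
    (hcongr : ∀ p : ℕ, p.Prime → p ≠ q → ((A p : ℤ) : ZMod 2) = ((B p : ℤ) : ZMod 2))
    (hres : ∃ k : ℕ, 1 ≤ k ∧ ∃ b : ℤ, Odd b ∧ ∃ m : ℤ, Odd m ∧
      ratPlusSymbol g ((b : ℚ) / 4 ^ k) = ratPlusSymbol g 0 + (m : ℚ) / 2) :
    ∀ Lplus Lminus : IwasawaAlgebra 2, IsPollackPair f 2 Lplus Lminus → ¬ PowerSeries.C (2 : ℤ_[2]) ∣ Lminus := by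
  haveI : NeZero q := ⟨hq.ne_zero⟩
  have h2N : ¬ 2 ∣ W.conductorNorm ℤ := by
    rw [W.dvd_conductorNorm_iff_not_hasGoodReductionAtPrime 2, not_not]
    exact hss.1
  have h2N₀ : ¬ 2 ∣ N₀ := fun h ↦ h2N (h.trans ⟨q, hN.symm⟩)
  have hqodd : Odd q := hq.odd_of_ne_two (by rintro rfl; exact h2N ⟨N₀, by rw [← hN, mul_comm]⟩)
  have h1 : N₀ * 1 ∣ W.conductorNorm ℤ := ⟨q, by rw [mul_one, hN]⟩
  have hq' : N₀ * q ∣ W.conductorNorm ℤ := by rw [hN]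
  have hΩg : plusPeriod g ≠ 0 := (IsNewform0.plusPeriod_pos_holds hg hQg).ne'
  have haev : Even (B 2) := by
    by_cases h2q : (2 : ℕ) = q
    · rw [h2q]; exact hBq
    · have h := hcongr 2 Nat.prime_two h2q
      have hA2 : A 2 = 0 := by
        have := hA 2 Nat.prime_two
        rw [hf.2 2, W.LFunction_apply_prime_eq_frobeniusTrace 2 hss.1, ha] at this
        exact_mod_cast this.symm
      rw [hA2, Int.cast_zero] at h
      exact even_iff_two_dvd.mpr ((ZMod.intCast_zmod_eq_zero_iff_dvd _ 2).mp h.symm)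
  -- the old family
  let δ : ℕ → (Gamma0 (W.conductorNorm ℤ) →* Gamma0 N₀) := fun t ↦
    if ht : t = q then Gamma0.degeneracyConj N₀ (W.conductorNorm ℤ) q hq' else Gamma0.degeneracyConj N₀ (W.conductorNorm ℤ) 1 h1
  have hδ1 : δ 1 = Gamma0.degeneracyConj N₀ (W.conductorNorm ℤ) 1 h1 := by
    simp only [δ, dif_neg hq.one_lt.ne]
  have hδq : δ q = Gamma0.degeneracyConj N₀ (W.conductorNorm ℤ) q hq' := by
    simp only [δ, dif_pos rfl]
  let H : CuspForm (Gamma0 (W.conductorNorm ℤ)) 2 :=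
    degeneracyMap0 N₀ (W.conductorNorm ℤ) 1 2 g + degeneracyMap0 N₀ (W.conductorNorm ℤ) q 2 g
  have hS1q : (1 : ℕ) ≠ q := hq.one_lt.ne
  have hHsym : ∀ γ : Gamma0 (W.conductorNorm ℤ), cuspSymbol H γ = ∑ t ∈ ({1, q} : Finset ℕ), cuspSymbol g (δ t γ) := by
    intro γ
    rw [Finset.sum_pair hS1q, hδ1, hδq, cuspSymbol_add, cuspSymbol_degeneracyMap0 h1, cuspSymbol_degeneracyMap0 hq']
  -- doubled real periods of the two old forms
  choose m₁ hm₁ using fun γ : Gamma0 (W.conductorNorm ℤ) ↦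
    exists_int_re_cuspSymbol_eq g hΩg (Gamma0.degeneracyConj N₀ (W.conductorNorm ℤ) 1 h1 γ)
  choose mq hmq using fun γ : Gamma0 (W.conductorNorm ℤ) ↦
    exists_int_re_cuspSymbol_eq g hΩg (Gamma0.degeneracyConj N₀ (W.conductorNorm ℤ) q hq' γ)
  have hre1 : ∀ γ, (cuspSymbol (degeneracyMap0 N₀ (W.conductorNorm ℤ) 1 2 g) γ).re = m₁ γ * (plusPeriod g / 2) := fun γ ↦ by
    rw [cuspSymbol_degeneracyMap0 h1, hm₁]
  have hreq : ∀ γ, (cuspSymbol (degeneracyMap0 N₀ (W.conductorNorm ℤ) q 2 g) γ).re = mq γ * (plusPeriod g / 2) := fun γ ↦ by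
    rw [cuspSymbol_degeneracyMap0 hq', hmq]
  have hreH : ∀ γ, (cuspSymbol H γ).re = (m₁ γ + mq γ : ℤ) * (plusPeriod g / 2) := fun γ ↦ by
    change (cuspSymbol (degeneracyMap0 N₀ (W.conductorNorm ℤ) 1 2 g + degeneracyMap0 N₀ (W.conductorNorm ℤ) q 2 g) γ).re = _
    rw [cuspSymbol_add, Complex.add_re, hre1, hreq]; push_cast; ring
  have hreal : ∀ n, (cuspCoeff g n).im = 0 := cuspCoeff_im_eq_zero_of_coeffField_eq_bot hQg
  refine flatAtTwo_of_namedFacts hBuz hSe hSD hMK hss ha hΔ hf A hA g hg hQg h2N₀ B hB haev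
    (fun p hp hpN ↦ hcongr p hp (by rintro rfl; exact hpN ⟨N₀, by rw [← hN, mul_comm]⟩))
    {1, q} ⟨1, by simp⟩ (fun t ht ↦ ?_) δ (fun t ht γ ↦ ?_) (fun t ht γ ↦ ?_) (fun t ht γ ↦ ?_) (fun t ht γ ↦ ?_)
    (fun t ht γ ↦ ?_) H hHsym (fun p hp hpN ↦ ?_) (fun p hp hpN γ σ hσ mσ mγ hmσ hmγ ↦ ?_) hres
  · -- S odd
    simp only [Finset.mem_insert, Finset.mem_singleton] at ht
    rcases ht with rfl | rfl
    exacts [odd_one, hqodd]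
  · -- entries (0,0)
    simp only [Finset.mem_insert, Finset.mem_singleton] at ht
    rcases ht with rfl | rfl
    · rw [hδ1]; rfl
    · rw [hδq]; rfl
  · -- entries (0,1)
    simp only [Finset.mem_insert, Finset.mem_singleton] at ht
    rcases ht with rfl | rfl
    · rw [hδ1]; exact (Gamma0.degeneracyConjElt_apply_zero_one h1 γ)
    · rw [hδq]; exact (Gamma0.degeneracyConjElt_apply_zero_one hq' γ)
  · -- entries (1,0)
    simp only [Finset.mem_insert, Finset.mem_singleton] at ht
    rcases ht with rfl | rfl
    · rw [hδ1]; rfl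
    · rw [hδq]; rfl
  · -- entries (1,1)
    simp only [Finset.mem_insert, Finset.mem_singleton] at ht
    rcases ht with rfl | rfl
    · rw [hδ1]; rfl
    · rw [hδq]; rfl
  · -- `t ∣ c`
    simp only [Finset.mem_insert, Finset.mem_singleton] at ht
    rcases ht with rfl | rfl
    · simp
    · have hγ := γ.2
      rw [Gamma0_mem] at hγ
      have hNc : ((W.conductorNorm ℤ : ℕ) : ℤ) ∣ (γ : SL(2, ℤ)) 1 0 := (ZMod.intCast_zmod_eq_zero_iff_dvd _ _).mp hγ
      exact (Int.natCast_dvd_natCast.mpr ⟨N₀, by rw [← hN, mul_comm]⟩).trans hNc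
  · -- `T_p H = a_p(g) H` for `p ∤ N`
    haveI : NeZero p := ⟨hp.ne_zero⟩
    change heckeT (Gamma0 (W.conductorNorm ℤ)) 2 p
      (degeneracyMap0 N₀ (W.conductorNorm ℤ) 1 2 g + degeneracyMap0 N₀ (W.conductorNorm ℤ) q 2 g) = _
    rw [map_add, heckeT_degeneracyMap0_of_isNewform0 h1 hg hp hpN, heckeT_degeneracyMap0_of_isNewform0 hq' hg hp hpN,
      ← smul_add]
    change cuspCoeff g p • H = _
    rw [hB p hp]
  · -- `hbad`: `p ∣ N`, so `p ∣ N₀` or `p = q`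
    haveI : NeZero p := ⟨hp.ne_zero⟩
    have hσH : cuspSymbol H σ = cuspSymbol (heckeT (Gamma0 (W.conductorNorm ℤ)) 2 p H) γ := by
      have := congrArg (fun φ : Module.Dual ℂ (CuspForm (Gamma0 (W.conductorNorm ℤ)) 2) ↦ φ H) hσ
      simpa only [periodFunctional_apply, LinearMap.dualMap_apply] using this
    have hpcases : p ∣ N₀ ∨ p = q := by
      rw [← hN] at hpN
      rcases (Nat.Prime.dvd_mul hp).mp hpN with h | h
      · exact Or.inl h
      · exact Or.inr ((Nat.prime_dvd_prime_iff_eq hp hq).mp h)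
    rcases hpcases with hpN₀ | rfl
    · -- `p ∣ N₀`: `T_p H = a_p(g) H`
      have hpq : p ≠ q := by rintro rfl; exact hqN₀ hpN₀
      have hT : heckeT (Gamma0 (W.conductorNorm ℤ)) 2 p H = ((B p : ℤ) : ℂ) • H := by
        have h := heckeT_oldFamily_of_dvd_level hq hN g hg hp hpN₀ hpq
        rw [hB p hp] at h
        exact h
      have h1' : cuspSymbol H σ = ((B p : ℤ) : ℂ) * cuspSymbol H γ := by rw [hσH, hT, cuspSymbol_smul]
      have h2 : mσ = B p * mγ := by
        apply int_eq_of_mul_plusPeriod_half_eq g hΩg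
        have := congrArg Complex.re h1'
        rw [show (((B p : ℤ) : ℂ)) = (((B p : ℤ) : ℝ) : ℂ) by norm_cast, Complex.re_ofReal_mul, hmσ, hmγ] at this
        rw [this]; push_cast; ring
      rw [h2, hcongr p hp hpq]; push_cast; ring
    · -- `p = q`: `T_q H = (a_q + q) D₁ − D_q`
      have hT : heckeT (Gamma0 (W.conductorNorm ℤ)) 2 p H = (cuspCoeff g p + p) • degeneracyMap0 N₀ (W.conductorNorm ℤ) 1 2 g
          - degeneracyMap0 N₀ (W.conductorNorm ℤ) p 2 g := heckeT_oldFamily_levelRaisingPrime hq hqN₀ hN g hg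
      have h1' : cuspSymbol H σ = (cuspCoeff g p + p) * cuspSymbol (degeneracyMap0 N₀ (W.conductorNorm ℤ) 1 2 g) γ
          - cuspSymbol (degeneracyMap0 N₀ (W.conductorNorm ℤ) p 2 g) γ := by
        rw [hσH, hT, ← periodFunctional_apply, map_sub, map_smul, periodFunctional_apply, periodFunctional_apply,
          smul_eq_mul]
      have h2 : mσ = (B p + p) * m₁ γ - mq γ := by
        apply int_eq_of_mul_plusPeriod_half_eq g hΩg
        have := congrArg Complex.re h1'
        rw [hB p hp, show (((B p : ℤ) : ℂ) + (p : ℂ)) = (((B p + p : ℤ) : ℝ) : ℂ) by push_cast; ring, Complex.sub_re,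
          Complex.re_ofReal_mul, hre1, hreq, hmσ] at this
        rw [this]; push_cast; ring
      have h3 : mγ = m₁ γ + mq γ := int_eq_of_mul_plusPeriod_half_eq g hΩg (by rw [← hmγ, hreH])
      obtain ⟨b, hb⟩ := hBq
      obtain ⟨c, hc⟩ := hAq
      obtain ⟨r, hr⟩ := hqodd
      rw [h2, h3, hb, hc, hr]
      push_cast
      have h20 : (2 : ZMod 2) = 0 := rfl
      linear_combination ((b : ZMod 2) * (m₁ γ : ZMod 2) + (r : ZMod 2) * (m₁ γ : ZMod 2) - (c : ZMod 2) * (m₁ γ : ZMod 2)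
        - (c : ZMod 2) * (mq γ : ZMod 2) - (mq γ : ZMod 2)) * h20

end Habitat

end MultOneDictionary

end Summit.BirchSwinnertonDyer.BirchSwinnertonDyer.Theorems.SignedMuAtTwo

end
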